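import Mathlib
import HarnessLib

/-!
# Spectral mapping for the matrix exponential: `σ(exp M) ⊆ exp(σ(M))`

Topic `Literature/Analysis/Matrix`. For a complex square matrix `M`, every point of the spectrum
of `exp M` is `exp λ` for an eigenvalue `λ` of `M` (`Matrix.spectrum_exp_subset_exp_spectrum`);
with Mathlib's converse inclusion `spectrum.exp_mem_exp` this is the finite-dimensional spectral
mapping theorem `σ(e^M) = e^{σ(M)}`. Folklore linear algebra (generalised eigenspace
decomposition; on `ker (M - λ)^k` one has `e^M - e^λ = (M - λ) Q` with `Q` commuting with `M`, so
`(e^M - e^λ)^k` vanishes there). Written for route `HubbardSuperconductivity/KkFloor`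
(`KkFloorTheorem`): it identifies `-log ρ(exp(-(A + zB)))` with the spectral abscissa
`min Re σ(A + zB)`, to which Vesentini's theorem (`Ransford1995_thm_6_4_2_holds`) is applied.
No definitions; everything is a theorem. The norm used inside proofs is the (scoped) `L²`-operator
norm `Matrix.Norms.L2Operator`; the statements do not depend on it.
-/

noncomputable section

open scoped Matrix.Norms.L2Operator

namespace Literature.Analysis.Matrix

variable {n : Type*} [Fintype n] [DecidableEq n]

/-- In a complex Banach algebra, `exp a - exp z · 1 = (a - z) * Q` for some `Q` commuting with
`a - z` (the entire function `(e^{w} - 1)/w` at `a - z`, times `e^{z}`). This is the computation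
inside Mathlib's `spectrum.exp_mem_exp`. [folklore] -/
theorem exp_sub_algebraMap_exp_eq {A : Type*} [NormedRing A] [NormedAlgebra ℂ A] [CompleteSpace A]
    (a : A) (z : ℂ) : ∃ Q : A, Commute (a - algebraMap ℂ A z) Q ∧
      NormedSpace.exp a - algebraMap ℂ A (NormedSpace.exp z) = (a - algebraMap ℂ A z) * Q := by
  let +nondep : NormedAlgebra ℚ A := .restrictScalars ℚ ℂ A
  set x := a - algebraMap ℂ A z with hx
  have hexpmul : NormedSpace.exp a = NormedSpace.exp x * algebraMap ℂ A (NormedSpace.exp z) := by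
    rw [NormedSpace.algebraMap_exp_comm z, ← NormedSpace.exp_add_of_commute
      (Algebra.commutes z x).symm, hx, sub_add_cancel]
  let b := ∑' k : ℕ, ((k + 1).factorial⁻¹ : ℂ) • x ^ k
  have hb : Summable fun k : ℕ => ((k + 1).factorial⁻¹ : ℂ) • x ^ k := by
    refine .of_norm_bounded_eventually (Real.summable_pow_div_factorial ‖x‖) ?_
    filter_upwards [Filter.eventually_cofinite_ne 0] with k hk
    rw [norm_smul, mul_comm, norm_inv, RCLike.norm_natCast, ← div_eq_mul_inv]
    gcongr
    · exact norm_pow_le' _ (pos_iff_ne_zero.mpr hk)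
    · exact k.le_succ
  have h₀ : (∑' k : ℕ, ((k + 1).factorial⁻¹ : ℂ) • x ^ (k + 1)) = x * b := by
    simpa only [mul_smul_comm, pow_succ'] using hb.tsum_mul_left x
  have h₁ : (∑' k : ℕ, ((k + 1).factorial⁻¹ : ℂ) • x ^ (k + 1)) = b * x := by
    simpa only [pow_succ, Algebra.smul_mul_assoc] using hb.tsum_mul_right x
  have h₃ : NormedSpace.exp x = 1 + x * b := by
    rw [NormedSpace.exp_eq_tsum ℂ]
    convert! (NormedSpace.expSeries_summable' (𝕂 := ℂ) x).tsum_eq_zero_add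
    · simp only [Nat.factorial_zero, Nat.cast_one, inv_one, pow_zero, one_smul]
    · exact h₀.symm
  refine ⟨b * algebraMap ℂ A (NormedSpace.exp z), ?_, ?_⟩
  · have hxb : Commute x b := (h₀.symm.trans h₁ :)
    exact hxb.mul_right (Algebra.commutes _ _).symm
  · rw [hexpmul, h₃, add_mul, one_mul, add_sub_cancel_left, mul_assoc]

/-- A linear map acting as a scalar on a vector acts by powers of the scalar under iteration.
[folklore] -/
theorem pow_apply_of_apply_eq_smul {V : Type*} [AddCommGroup V] [Module ℂ V]
    (T : Module.End ℂ V) (w : V) (s : ℂ) (h : T w = s • w) (k : ℕ) : (T ^ k) w = s ^ k • w := by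
  induction k with
  | zero => simp
  | succ k ih => rw [pow_succ, Module.End.mul_apply, h, map_smul, ih, smul_smul, pow_succ']

/-- **Spectral mapping for the matrix exponential (the non-trivial inclusion).** For a complex
square matrix `M`, every `μ ∈ σ(exp M)` is of the form `exp λ₀` with `λ₀ ∈ σ(M)`. Proof: take an
eigenvector `v` of `exp M` for `μ`, decompose it along the generalised eigenspaces of `M`
(`⨆_λ ker (M-λ)^∞ = ⊤`, independent family); as `exp M` commutes with `M` each component is again
an eigenvector for `μ` (or zero). On a nonzero component `w ∈ ker (M - λ₀)^k` write
`exp M - e^{λ₀} = (M - λ₀) Q` with `[M, Q] = 0` (`exp_sub_algebraMap_exp_eq`), so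
`(μ - e^{λ₀})^k w = (exp M - e^{λ₀})^k w = Q^k (M - λ₀)^k w = 0`, whence `μ = e^{λ₀}`. [folklore] -/
theorem spectrum_exp_subset_exp_spectrum (M : Matrix n n ℂ) :
    ∀ μ ∈ spectrum ℂ (NormedSpace.exp M), ∃ lam ∈ spectrum ℂ M, μ = NormedSpace.exp lam := by
  intro μ hμ
  -- the linear maps
  set f : Module.End ℂ (n → ℂ) := Matrix.toLin' M with hf
  set g : Module.End ℂ (n → ℂ) := Matrix.toLin' (NormedSpace.exp M) with hg
  have hspec_g : spectrum ℂ g = spectrum ℂ (NormedSpace.exp M) :=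
    AlgEquiv.spectrum_eq (Matrix.toLinAlgEquiv' : Matrix n n ℂ ≃ₐ[ℂ] _) _
  have hspec_f : spectrum ℂ f = spectrum ℂ M :=
    AlgEquiv.spectrum_eq (Matrix.toLinAlgEquiv' : Matrix n n ℂ ≃ₐ[ℂ] _) _
  -- an eigenvector of `exp M`
  have hμg : g.HasEigenvalue μ := by
    rw [Module.End.hasEigenvalue_iff_mem_spectrum, hspec_g]
    exact hμ
  obtain ⟨v, hv⟩ := hμg.exists_hasEigenvector
  have hv0 : v ≠ 0 := hv.2
  have hgv : g v = μ • v := Module.End.mem_eigenspace_iff.mp hv.1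
  -- `exp M` commutes with `M`
  have hcomm : Commute f g := by
    have hc : Commute M (NormedSpace.exp M) := Commute.exp_right (Commute.refl M)
    show f * g = g * f
    rw [hf, hg, Module.End.mul_eq_comp, Module.End.mul_eq_comp, ← Matrix.toLin'_mul,
      ← Matrix.toLin'_mul, hc.eq]
  have hcomm' : Commute f (g - μ • 1) := hcomm.sub_right (Commute.smul_right (Commute.one_right f) μ)
  -- decomposition along generalised eigenspaces
  have htop := Module.End.iSup_maxGenEigenspace_eq_top f
  have hvtop : v ∈ ⨆ lam, f.maxGenEigenspace lam := by rw [htop]; exact Submodule.mem_top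
  obtain ⟨c, hc, hcsum⟩ := (Submodule.mem_iSup_iff_exists_finsupp _ _).mp hvtop
  -- each component is killed by `g - μ`
  have hind := Module.End.independent_maxGenEigenspace f
  have hcomp : ∀ lam, (g - μ • 1) (c lam) = 0 := by
    intro lam
    have hsum0 : (c.sum fun _ y => (g - μ • 1) y) = 0 := by
      have : (g - μ • 1) (c.sum fun _ y => y) = 0 := by
        rw [hcsum, LinearMap.sub_apply, hgv]
        simp
      rwa [map_finsuppSum] at this
    -- the `lam`-component equals minus the sum of the others
    have hmem : ∀ l, (g - μ • 1) (c l) ∈ f.maxGenEigenspace l := fun l =>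
      Module.End.mapsTo_maxGenEigenspace_of_comm hcomm' l (hc l)
    by_cases hl : lam ∈ c.support
    · have hsplit := Finset.add_sum_erase c.support (fun l => (g - μ • 1) (c l)) hl
      rw [Finsupp.sum] at hsum0
      rw [hsum0] at hsplit
      have hrest : (∑ l ∈ c.support.erase lam, (g - μ • 1) (c l)) ∈
          ⨆ (l) (_ : l ≠ lam), f.maxGenEigenspace l := by
        refine Submodule.sum_mem _ fun l hl' => ?_
        have hne : l ≠ lam := Finset.ne_of_mem_erase hl'
        exact Submodule.mem_iSup_of_mem l (Submodule.mem_iSup_of_mem hne (hmem l))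
      have hself : (g - μ • 1) (c lam) ∈ ⨆ (l) (_ : l ≠ lam), f.maxGenEigenspace l := by
        have : (g - μ • 1) (c lam) = -(∑ l ∈ c.support.erase lam, (g - μ • 1) (c l)) :=
          eq_neg_of_add_eq_zero_left hsplit
        rw [this]
        exact Submodule.neg_mem _ hrest
      exact (Submodule.disjoint_def.mp (hind lam)) _ (hmem lam) hself
    · have : c lam = 0 := Finsupp.notMem_support_iff.mp hl
      rw [this, map_zero]
  -- a nonzero component
  obtain ⟨lam₀, hlam₀⟩ : ∃ lam, c lam ≠ 0 := by
    by_contra hno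
    push Not at hno
    apply hv0
    rw [← hcsum, Finsupp.sum]
    exact Finset.sum_eq_zero fun l _ => hno l
  set w := c lam₀ with hw
  have hgw : g w = μ • w := by
    have := hcomp lam₀
    rw [LinearMap.sub_apply, sub_eq_zero] at this
    simpa using this
  obtain ⟨k, hk⟩ := (Module.End.mem_maxGenEigenspace f lam₀ w).mp (hc lam₀)
  -- `exp M - e^{lam₀} = (M - lam₀) Q`
  obtain ⟨Q, hQc, hQ⟩ := exp_sub_algebraMap_exp_eq M lam₀
  have hX : Matrix.toLin' (M - algebraMap ℂ _ lam₀) = f - lam₀ • 1 := by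
    rw [map_sub, hf, Algebra.algebraMap_eq_smul_one, map_smul, Matrix.toLin'_one]
    rfl
  have htoLin_pow : ∀ (X : Matrix n n ℂ) (j : ℕ), Matrix.toLin' (X ^ j) = Matrix.toLin' X ^ j := by
    intro X j
    induction j with
    | zero => rw [pow_zero, pow_zero, Matrix.toLin'_one]; rfl
    | succ j ih => rw [pow_succ, Matrix.toLin'_mul, ih, pow_succ, Module.End.mul_eq_comp]
  set e : ℂ := NormedSpace.exp lam₀ with he
  have hpow : Matrix.toLin' ((NormedSpace.exp M - algebraMap ℂ _ e) ^ k) w = 0 := by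
    rw [hQ, hQc.mul_pow, (hQc.pow_pow k k).eq, Matrix.toLin'_mul, LinearMap.comp_apply,
      htoLin_pow, htoLin_pow, hX, hk, map_zero]
  have hscal : Matrix.toLin' ((NormedSpace.exp M - algebraMap ℂ _ e) ^ k) w = (μ - e) ^ k • w := by
    rw [htoLin_pow]
    refine pow_apply_of_apply_eq_smul _ w (μ - e) ?_ k
    rw [map_sub, Algebra.algebraMap_eq_smul_one, map_smul, Matrix.toLin'_one, ← hg,
      LinearMap.sub_apply, hgw, LinearMap.smul_apply, LinearMap.id_apply, sub_smul]
  rw [hpow] at hscal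
  have hμe : μ = e := by
    have h0 : (μ - e) ^ k = 0 := by
      rcases smul_eq_zero.mp hscal.symm with h | h
      · exact h
      · exact absurd h hlam₀
    exact sub_eq_zero.mp (pow_eq_zero_iff'.mp h0).1
  -- `lam₀` is in the spectrum of `M`
  refine ⟨lam₀, ?_, hμe⟩
  rw [← hspec_f, spectrum.mem_iff]
  intro hunit
  apply hlam₀
  have hinj : Function.Injective (algebraMap ℂ (Module.End ℂ (n → ℂ)) lam₀ - f) :=
    (Module.End.isUnit_iff _).mp hunit |>.injective
  have hinj' : Function.Injective
      (((f - lam₀ • 1) ^ k : Module.End ℂ (n → ℂ)) : (n → ℂ) → (n → ℂ)) := by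
    have hneg : f - lam₀ • (1 : Module.End ℂ (n → ℂ)) = -(algebraMap ℂ _ lam₀ - f) := by
      rw [Algebra.algebraMap_eq_smul_one, neg_sub]
    rw [Module.End.coe_pow]
    refine Function.Injective.iterate ?_ k
    rw [hneg]
    intro a b hab
    exact hinj (neg_injective hab)
  exact hinj' (by rw [hk, map_zero])

end Literature.Analysis.Matrix
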